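import Summits.CriticalPhenomena.PercolationContinuityZ3.Theorems.PercNearOneGluingNoHeavyLowerTailThreeFamilyRank

/-!
# Four-family count: three genuine groups plus an orthogonal pseudo-class

Helper file for crux `stmt-CriticalPhenomena-4575` (`NoHeavyLowerTail`, route `PercNearOneGluingNoHeavy`),
new-inequality factory seat `prim-ineq-gen-3` (gen 12).  Everything in this file is PROVED.

In the setting of Theorem A′ (`ThreeFamilyRank.card_add_card_add_card_le`): `G` a down-closed family of sets,
`V G T ⊆ ℚ^G` the span of the plain vectors `([E ⊆ X])_{E ∈ G}` (`X ∈ T`), `B` the signed coordinate form.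
Let `P, Q, R, Y` be four families whose spans have full dimension, which are pairwise cross-orthogonal
(every cross meet lies in `G` and is nonempty), such that the triple intersection of the three *genuine*
spans vanishes (`V_P ⊓ V_Q ⊓ V_R = ⊥`, supplied by TRIPLE⁻) and the *pseudo-class* `Y` has no vector in the
sum of the two *outer* spans (`V_Y ⊓ (V_P ⊔ V_R) = ⊥`).  Then

  `#P + #Q + #R + #Y ≤ #G`.

Proof (modular law).  With `A₁ = V_P ⊓ V_R`, `A₂ = (V_P ⊔ V_R) ⊓ V_Q`, `A₃ = (V_P ⊔ V_R ⊔ V_Q) ⊓ V_Y` and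
`U = V_P ⊔ V_R ⊔ V_Q ⊔ V_Y` one has `#P + #R + #Q + #Y = dim U + dim A₁ + dim A₂ + dim A₃`; all three `A_i`
are `B`-orthogonal to `U`; `A₁ ⊓ A₂ ≤ V_P ⊓ V_Q ⊓ V_R = ⊥` and `(A₁ ⊔ A₂) ⊓ A₃ ≤ (V_P ⊔ V_R) ⊓ V_Y = ⊥`, so
`dim A₁ + dim A₂ + dim A₃ = dim (A₁ ⊔ A₂ ⊔ A₃) ≤ dim U^⊥ = #G - dim U`.

Use (memo FINDINGS-gen12.md of the seat): this is the linear-algebra socket of the '4-family certificates'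
for the four-petal tournaments — the three genuine groups are the classes of a valid three-group certificate in
the *enlarged* coordinate family `𝒢 = K₀ ∪ 𝒴`, the pseudo-class `𝒴` (half co-goods of one petal) is
`B`-orthogonal to every genuine member, and `#P + #Q + #R + #𝒴 ≤ #𝒢` gives the Hall count `#D ≤ #K₀`.
(prim-ineq-gen-3 gen 12, 2026-08-20.)
-/

namespace Summit.CriticalPhenomena.PercolationContinuityZ3.Theorems

namespace ThreeFamilyRank

open Finset Module

variable {α : Type*} [DecidableEq α]

/-- A vector which is `B`-orthogonal to all plain vectors of four families lies in the `B`-orthogonal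
complement of the sum of their spans. -/
theorem mem_orthogonal_of_forall₄ (G : Finset (Finset α)) {P Q R Y : Finset (Finset α)} {w : Vec G}
    (hP : ∀ X ∈ P, sform G (chi G X) w = 0) (hQ : ∀ X ∈ Q, sform G (chi G X) w = 0)
    (hR : ∀ X ∈ R, sform G (chi G X) w = 0) (hY : ∀ X ∈ Y, sform G (chi G X) w = 0) :
    w ∈ (sform G).orthogonal (V G P ⊔ V G Q ⊔ V G R ⊔ V G Y) := by
  rw [LinearMap.BilinForm.mem_orthogonal_iff]
  intro n hn
  have aux : ∀ S : Finset (Finset α), (∀ X ∈ S, sform G (chi G X) w = 0) →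
      V G S ≤ LinearMap.ker ((sform G).flip w) := by
    intro S hS
    rw [V, Submodule.span_le]
    rintro _ ⟨X, rfl⟩
    simp only [SetLike.mem_coe, LinearMap.mem_ker]
    exact hS X X.2
  have hle : V G P ⊔ V G Q ⊔ V G R ⊔ V G Y ≤ LinearMap.ker ((sform G).flip w) :=
    sup_le (sup_le (sup_le (aux P hP) (aux Q hQ)) (aux R hR)) (aux Y hY)
  exact LinearMap.mem_ker.mp (hle hn)

/-- **Four-family count (gen 12).**  `G` down-closed; `P, Q, R, Y` four families with full-dimensional
spans, pairwise cross-orthogonal (cross meets in `G` and nonempty); the triple intersection of the spans of the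
three genuine groups `P, Q, R` is trivial and the pseudo-class span `V G Y` meets the sum of the two outer
spans `V G P ⊔ V G R` trivially.  Then `#P + #Q + #R + #Y ≤ #G`. -/
theorem card_add_card_add_card_add_card_le_of_finrank (G : Finset (Finset α))
    (hG : ∀ E ∈ G, ∀ F, F ⊆ E → F ∈ G)
    (P Q R Y : Finset (Finset α))
    (hP : finrank ℚ (V G P) = #P) (hQ : finrank ℚ (V G Q) = #Q) (hR : finrank ℚ (V G R) = #R)
    (hY : finrank ℚ (V G Y) = #Y)
    (hPQ : ∀ X ∈ P, ∀ Z ∈ Q, X ∩ Z ∈ G ∧ (X ∩ Z).Nonempty)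
    (hQR : ∀ X ∈ Q, ∀ Z ∈ R, X ∩ Z ∈ G ∧ (X ∩ Z).Nonempty)
    (hRP : ∀ X ∈ R, ∀ Z ∈ P, X ∩ Z ∈ G ∧ (X ∩ Z).Nonempty)
    (hPY : ∀ X ∈ P, ∀ Z ∈ Y, X ∩ Z ∈ G ∧ (X ∩ Z).Nonempty)
    (hQY : ∀ X ∈ Q, ∀ Z ∈ Y, X ∩ Z ∈ G ∧ (X ∩ Z).Nonempty)
    (hRY : ∀ X ∈ R, ∀ Z ∈ Y, X ∩ Z ∈ G ∧ (X ∩ Z).Nonempty)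
    (htriple : V G P ⊓ V G Q ⊓ V G R = ⊥)
    (hYsum : V G Y ⊓ (V G P ⊔ V G R) = ⊥) :
    #P + #Q + #R + #Y ≤ #G := by
  -- symmetric versions of the cross hypotheses
  have sym : ∀ {S T : Finset (Finset α)}, (∀ X ∈ S, ∀ Z ∈ T, X ∩ Z ∈ G ∧ (X ∩ Z).Nonempty) →
      ∀ Z ∈ T, ∀ X ∈ S, Z ∩ X ∈ G ∧ (Z ∩ X).Nonempty := by
    intro S T h Z hZ X hX
    rw [Finset.inter_comm]
    exact h X hX Z hZ
  have hQP := sym hPQ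
  have hRQ := sym hQR
  have hPR := sym hRP
  have hYP := sym hPY
  have hYQ := sym hQY
  have hYR := sym hRY
  -- the three defect spaces
  set A₁ : Submodule ℚ (Vec G) := V G P ⊓ V G R with hA₁
  set A₂ : Submodule ℚ (Vec G) := (V G P ⊔ V G R) ⊓ V G Q with hA₂
  set A₃ : Submodule ℚ (Vec G) := (V G P ⊔ V G R ⊔ V G Q) ⊓ V G Y with hA₃
  set U : Submodule ℚ (Vec G) := V G P ⊔ V G Q ⊔ V G R ⊔ V G Y with hU
  -- every defect space is `B`-orthogonal to `U`
  have kerP : ∀ X ∈ P, V G Q ⊔ V G R ⊔ V G Y ≤ LinearMap.ker (sform G (chi G X)) := fun X hX =>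
    sup_le (sup_le (V_le_ker_sform_chi G hG (hPQ X hX)) (V_le_ker_sform_chi G hG (hPR X hX)))
      (V_le_ker_sform_chi G hG (hPY X hX))
  have kerQ : ∀ X ∈ Q, V G P ⊔ V G R ⊔ V G Y ≤ LinearMap.ker (sform G (chi G X)) := fun X hX =>
    sup_le (sup_le (V_le_ker_sform_chi G hG (hQP X hX)) (V_le_ker_sform_chi G hG (hQR X hX)))
      (V_le_ker_sform_chi G hG (hQY X hX))
  have kerR : ∀ X ∈ R, V G P ⊔ V G Q ⊔ V G Y ≤ LinearMap.ker (sform G (chi G X)) := fun X hX =>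
    sup_le (sup_le (V_le_ker_sform_chi G hG (hRP X hX)) (V_le_ker_sform_chi G hG (hRQ X hX)))
      (V_le_ker_sform_chi G hG (hRY X hX))
  have kerY : ∀ X ∈ Y, V G P ⊔ V G Q ⊔ V G R ≤ LinearMap.ker (sform G (chi G X)) := fun X hX =>
    sup_le (sup_le (V_le_ker_sform_chi G hG (hYP X hX)) (V_le_ker_sform_chi G hG (hYQ X hX)))
      (V_le_ker_sform_chi G hG (hYR X hX))
  have orthA₁ : A₁ ≤ (sform G).orthogonal U := by
    intro w hw
    rw [hA₁, Submodule.mem_inf] at hw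
    rw [hU]
    refine mem_orthogonal_of_forall₄ G (fun X hX => ?_) (fun X hX => ?_) (fun X hX => ?_) (fun X hX => ?_)
    · exact kerP X hX (Submodule.mem_sup_left (Submodule.mem_sup_right hw.2))
    · exact kerQ X hX (Submodule.mem_sup_left (Submodule.mem_sup_left hw.1))
    · exact kerR X hX (Submodule.mem_sup_left (Submodule.mem_sup_left hw.1))
    · exact kerY X hX (Submodule.mem_sup_left (Submodule.mem_sup_left hw.1))
  have orthA₂ : A₂ ≤ (sform G).orthogonal U := by
    intro w hw
    rw [hA₂, Submodule.mem_inf] at hw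
    rw [hU]
    refine mem_orthogonal_of_forall₄ G (fun X hX => ?_) (fun X hX => ?_) (fun X hX => ?_) (fun X hX => ?_)
    · exact kerP X hX (Submodule.mem_sup_left (Submodule.mem_sup_left hw.2))
    · -- w ∈ V P ⊔ V R ≤ ker
      have hle : V G P ⊔ V G R ≤ LinearMap.ker (sform G (chi G X)) :=
        sup_le (V_le_ker_sform_chi G hG (hQP X hX)) (V_le_ker_sform_chi G hG (hQR X hX))
      exact hle hw.1
    · exact kerR X hX (Submodule.mem_sup_left (Submodule.mem_sup_right hw.2))
    · exact kerY X hX (Submodule.mem_sup_left (Submodule.mem_sup_right hw.2))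
  have orthA₃ : A₃ ≤ (sform G).orthogonal U := by
    intro w hw
    rw [hA₃, Submodule.mem_inf] at hw
    rw [hU]
    refine mem_orthogonal_of_forall₄ G (fun X hX => ?_) (fun X hX => ?_) (fun X hX => ?_) (fun X hX => ?_)
    · exact kerP X hX (Submodule.mem_sup_right hw.2)
    · exact kerQ X hX (Submodule.mem_sup_right hw.2)
    · exact kerR X hX (Submodule.mem_sup_right hw.2)
    · have hle : V G P ⊔ V G R ⊔ V G Q ≤ LinearMap.ker (sform G (chi G X)) :=
        sup_le (sup_le (V_le_ker_sform_chi G hG (hYP X hX)) (V_le_ker_sform_chi G hG (hYR X hX)))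
          (V_le_ker_sform_chi G hG (hYQ X hX))
      exact hle hw.1
  -- the defect spaces are independent
  have hA₁₂ : A₁ ⊓ A₂ = ⊥ := by
    rw [eq_bot_iff]
    intro w hw
    rw [hA₁, hA₂, Submodule.mem_inf, Submodule.mem_inf, Submodule.mem_inf] at hw
    have : w ∈ V G P ⊓ V G Q ⊓ V G R := by
      simp only [Submodule.mem_inf]
      exact ⟨⟨hw.1.1, hw.2.2⟩, hw.1.2⟩
    rw [htriple] at this
    exact this
  have hA₁₂₃ : (A₁ ⊔ A₂) ⊓ A₃ = ⊥ := by
    rw [eq_bot_iff]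
    intro w hw
    rw [Submodule.mem_inf] at hw
    have h12 : A₁ ⊔ A₂ ≤ V G P ⊔ V G R := by
      refine sup_le ?_ ?_
      · rw [hA₁]; exact le_trans inf_le_left le_sup_left
      · rw [hA₂]; exact inf_le_left
    have hwY : w ∈ V G Y := by
      have := hw.2; rw [hA₃, Submodule.mem_inf] at this; exact this.2
    have : w ∈ V G Y ⊓ (V G P ⊔ V G R) := Submodule.mem_inf.mpr ⟨hwY, h12 hw.1⟩
    rw [hYsum] at this
    exact this
  -- modular-law bookkeeping
  have h1 := Submodule.finrank_sup_add_finrank_inf_eq (V G P) (V G R)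
  have h2 := Submodule.finrank_sup_add_finrank_inf_eq (V G P ⊔ V G R) (V G Q)
  have h3 := Submodule.finrank_sup_add_finrank_inf_eq (V G P ⊔ V G R ⊔ V G Q) (V G Y)
  have h4 := Submodule.finrank_sup_add_finrank_inf_eq A₁ A₂
  have h5 := Submodule.finrank_sup_add_finrank_inf_eq (A₁ ⊔ A₂) A₃
  have h4' : finrank ℚ ↥(A₁ ⊓ A₂) = 0 := by rw [hA₁₂, finrank_bot]
  have h5' : finrank ℚ ↥((A₁ ⊔ A₂) ⊓ A₃) = 0 := by rw [hA₁₂₃, finrank_bot]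
  have hUeq : U = V G P ⊔ V G R ⊔ V G Q ⊔ V G Y := by
    rw [hU]; ac_rfl
  have h6 : finrank ℚ ↥(A₁ ⊔ A₂ ⊔ A₃) ≤ finrank ℚ ↥((sform G).orthogonal U) :=
    Submodule.finrank_mono (sup_le (sup_le orthA₁ orthA₂) orthA₃)
  have h7 := LinearMap.BilinForm.finrank_orthogonal (sform_nondegenerate G) U
  have h8 := finrank_Vec G
  have h9 : finrank ℚ ↥U ≤ finrank ℚ (Vec G) := Submodule.finrank_le _
  have h10 : finrank ℚ ↥(V G P ⊔ V G R ⊔ V G Q ⊔ V G Y) = finrank ℚ ↥U := by rw [hUeq]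
  rw [← hA₁] at h1
  rw [← hA₂] at h2
  rw [← hA₃] at h3
  omega

end ThreeFamilyRank

end Summit.CriticalPhenomena.PercolationContinuityZ3.Theorems
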